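import Literature.NumberTheory.Rogawski1990.LocalTransferExplicitNonsplit
import Literature.NumberTheory.Rogawski1990.SmoothTransferSplitPlace
import Literature.NumberTheory.Automorphic.OrbitalMeasureCanonicalExistsCM
import Literature.NumberTheory.GaloisRepresentations.HeckeCharacterConjugateDualOfQuadraticCM
import HarnessLib

/-!
# [Rogawski1990 §4.9 Prop. 4.9.1 (a) p. 55, split places] The N6 SPLIT-HALF JUNCTION `hS`: canonical families exist, so the split clause of
# `LocalTransferExplicit` reduces to «transfer exists for EVERY canonical pair at a split place»; and N6 ⟸ (that) ∧ N6-ns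

Topic `NumberTheory/Rogawski1990`; namespace `Literature.NumberTheory.Rogawski1990`. THEOREMS ONLY (no definition, no instance, no notation, no named fact, no
`sorry`). Cell `pub/hodgecm-mathlib`, crux H413, letter N6 (#102) split half, brick «N6-SPLIT HALF JUNCTION `hS`» (LEAD F0P3a-plan (g8) T7-84). The `hS`
binder of ★ (J5) `localTransferExplicit_of_split_of_nonsplit` ∕ ★ `localTransferExplicit_of_split_of_nonsplitLetter` asks, at every finite `v` that splits in
`L`, for `∃ mH mG` CANONICAL with a `Δ‴_v`-transfer. ★ `exists_isCanonical_pair` (`OrbitalMeasureCanonicalExistsCM`) produces the canonical pair for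
`H′` hermitian with `det H′ ≠ 0`; hence:

* **`localTransferExplicit_splitHalf_of_transfer`** — `hS` follows from the transfer clause for EVERY canonical pair at a split place,
  `hT : ∀ v w, c • w ≠ w → ∀ mH mG, mH.IsCanonical … → mG.IsCanonical … → IsLocalDeltaTransferExists … mH mG IsLocSmooth IsLocSmooth` (the shape of the
  «D-N6s» chain's head, B5-A PART 2 (b)), under the frame guards `hherm` (`ᵗ(c H′) = H′`) and `hanis` (`H′` anisotropic ⇒ `det H′ ≠ 0`,
  `Matrix.exists_mulVec_eq_zero_iff`);
* **`localTransferExplicit_of_transfer_of_nonsplitLetter`** — N6 at a frame ⟸ `hT` ∧ ★ `LocalTransferExplicitNonsplit` (★ B-p08's assembler with `hS`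
  discharged).
* **`localTransferExplicit_splitHalf`** — `hT` DISCHARGED by the «D-N6s» chain's closing brick ★ `isLocalDeltaTransferExists_finExplicit_of_split` (B5-A PART 2 (b),
  B-p12): under the frame guards `hμω` (`μ|_{𝕀_{L⁺}} = ω_{L∕L⁺}`, giving `hdual` by ★ `HeckeCharacter.galConj_eq_inv_of_restrict_eq_quadraticHeckeCharCM`), `hherm`,
  `hanis`, the `hS` clause HOLDS — the split half of letter N6 (#102) in-house; **`localTransferExplicit_of_nonsplitLetter`** — N6 at a frame ⟸ ★
  `LocalTransferExplicitNonsplit`; **`localTransferExplicitClosed_of_nonsplitClosed`** — `LocalTransferExplicitNonsplitClosed → LocalTransferExplicitClosed` (the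
  closer's one-liner: «N6 ⟸ N6-ns»).
HONEST LABEL: HC_CM is proved only modulo the printed citations until rung 0 closes; this file discharges none of them.

## References
* [Rogawski1990] J. D. Rogawski, *Automorphic Representations of Unitary Groups in Three Variables*, Ann. of Math. Stud. 123 (1990), §4.9 Prop. 4.9.1 (a) p. 55;
  §4.3 (4.3.1) p. 43.
* [LanglandsShelstad1990Descent] R. P. Langlands, D. Shelstad, *Descent for transfer factors*, The Grothendieck Festschrift II (1990), Thm. 6.2.
* [Deligne1979ShimuraVarieties] P. Deligne, *Variétés de Shimura*, Corvallis II (1979), Prop. 2.3.10 (anisotropic hermitian forms are non-degenerate).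
-/

set_option autoImplicit false

noncomputable section

open NumberField IsDedekindDomain MeasureTheory Measure
open Literature.NumberTheory.Automorphic Literature.NumberTheory.GaloisRepresentations
open Literature.AlgebraicGeometry.ShimuraVarieties (unitaryGroup hermForm)
open scoped Matrix MatrixGroups Classical

namespace Literature.NumberTheory.Rogawski1990

/-- **`H` anisotropic ⟹ `det H ≠ 0`** (a kernel vector would be isotropic; Mathlib `Matrix.exists_mulVec_eq_zero_iff`) — a local copy of ★
`UnitaryCanonicalModel.Aux.det_ne_zero_of_anisotropic` (not imported: Shimura-variety closure). [cite: Deligne1979ShimuraVarieties, Prop. 2.3.10] -/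
private theorem det_ne_zero_of_anisotropic' {L : Type} [Field L] [NumberField L] [IsCMField L] {H : Matrix (Fin 3) (Fin 3) L}
    (hH0 : ∀ v : Fin 3 → L, hermForm (cmConjRingHom L) H v v = 0 → v = 0) : H.det ≠ 0 := by
  intro hdet
  obtain ⟨v, hv, hHv⟩ := Matrix.exists_mulVec_eq_zero_iff.mpr hdet
  refine hv (hH0 v ?_)
  rw [hermForm, hHv, dotProduct_zero]

section Frame

variable (L : Type) [Field L] [NumberField L] [IsCMField L] (H' : Matrix (Fin 3) (Fin 3) L) (μ : HeckeCharacter L)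
    [∀ v : HeightOneSpectrum (𝓞 ↥(maximalRealSubfield L)),
      MeasurableSpace ((UnitaryGroup.cmDatum L 2 (Matrix.of fun i j : Fin 2 => if i.val + j.val + 1 = 2 then (1 : L) else 0)).Local v ×
        (UnitaryGroup.cmDatum L 1 (Matrix.of fun i j : Fin 1 => if i.val + j.val + 1 = 1 then (1 : L) else 0)).Local v)]
    [∀ v : HeightOneSpectrum (𝓞 ↥(maximalRealSubfield L)),
      BorelSpace ((UnitaryGroup.cmDatum L 2 (Matrix.of fun i j : Fin 2 => if i.val + j.val + 1 = 2 then (1 : L) else 0)).Local v ×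
        (UnitaryGroup.cmDatum L 1 (Matrix.of fun i j : Fin 1 => if i.val + j.val + 1 = 1 then (1 : L) else 0)).Local v)]
    [∀ v : HeightOneSpectrum (𝓞 ↥(maximalRealSubfield L)), MeasurableSpace ((UnitaryGroup.cmDatum L 3 H').Local v)]
    [∀ v : HeightOneSpectrum (𝓞 ↥(maximalRealSubfield L)), BorelSpace ((UnitaryGroup.cmDatum L 3 H').Local v)]
    (νH : ∀ v : HeightOneSpectrum (𝓞 ↥(maximalRealSubfield L)),
      Measure ((UnitaryGroup.cmDatum L 2 (Matrix.of fun i j : Fin 2 => if i.val + j.val + 1 = 2 then (1 : L) else 0)).Local v ×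
        (UnitaryGroup.cmDatum L 1 (Matrix.of fun i j : Fin 1 => if i.val + j.val + 1 = 1 then (1 : L) else 0)).Local v))
    (νG : ∀ v : HeightOneSpectrum (𝓞 ↥(maximalRealSubfield L)), Measure ((UnitaryGroup.cmDatum L 3 H').Local v))
    [∀ v, (νH v).IsHaarMeasure] [∀ v, (νH v).IsMulRightInvariant] [∀ v, (νG v).IsHaarMeasure] [∀ v, (νG v).IsMulRightInvariant]

variable
    -- σ-algebras on the orbit spaces for the SPLIT-clause hypothesis: ARBITRARY Borel structures, as in ★ (J5) (the letters fix `borel`; reduced inside)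
    [iH : ∀ (v : HeightOneSpectrum (𝓞 ↥(maximalRealSubfield L)))
        (a : (UnitaryGroup.cmDatum L 2 (Matrix.of fun i j : Fin 2 => if i.val + j.val + 1 = 2 then (1 : L) else 0)).Local v ×
          (UnitaryGroup.cmDatum L 1 (Matrix.of fun i j : Fin 1 => if i.val + j.val + 1 = 1 then (1 : L) else 0)).Local v),
        MeasurableSpace (((UnitaryGroup.cmDatum L 2 (Matrix.of fun i j : Fin 2 => if i.val + j.val + 1 = 2 then (1 : L) else 0)).Local v ×
          (UnitaryGroup.cmDatum L 1 (Matrix.of fun i j : Fin 1 => if i.val + j.val + 1 = 1 then (1 : L) else 0)).Local v) ⧸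
          Subgroup.centralizer ({a} : Set ((UnitaryGroup.cmDatum L 2 (Matrix.of fun i j : Fin 2 => if i.val + j.val + 1 = 2 then (1 : L) else 0)).Local v ×
          (UnitaryGroup.cmDatum L 1 (Matrix.of fun i j : Fin 1 => if i.val + j.val + 1 = 1 then (1 : L) else 0)).Local v)))]
    [bH : ∀ (v : HeightOneSpectrum (𝓞 ↥(maximalRealSubfield L)))
        (a : (UnitaryGroup.cmDatum L 2 (Matrix.of fun i j : Fin 2 => if i.val + j.val + 1 = 2 then (1 : L) else 0)).Local v ×
          (UnitaryGroup.cmDatum L 1 (Matrix.of fun i j : Fin 1 => if i.val + j.val + 1 = 1 then (1 : L) else 0)).Local v),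
        BorelSpace (((UnitaryGroup.cmDatum L 2 (Matrix.of fun i j : Fin 2 => if i.val + j.val + 1 = 2 then (1 : L) else 0)).Local v ×
          (UnitaryGroup.cmDatum L 1 (Matrix.of fun i j : Fin 1 => if i.val + j.val + 1 = 1 then (1 : L) else 0)).Local v) ⧸
          Subgroup.centralizer ({a} : Set ((UnitaryGroup.cmDatum L 2 (Matrix.of fun i j : Fin 2 => if i.val + j.val + 1 = 2 then (1 : L) else 0)).Local v ×
          (UnitaryGroup.cmDatum L 1 (Matrix.of fun i j : Fin 1 => if i.val + j.val + 1 = 1 then (1 : L) else 0)).Local v)))]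
    [iG : ∀ (v : HeightOneSpectrum (𝓞 ↥(maximalRealSubfield L))) (γ : (UnitaryGroup.cmDatum L 3 H').Local v),
        MeasurableSpace ((UnitaryGroup.cmDatum L 3 H').Local v ⧸ Subgroup.centralizer ({γ} : Set ((UnitaryGroup.cmDatum L 3 H').Local v)))]
    [bG : ∀ (v : HeightOneSpectrum (𝓞 ↥(maximalRealSubfield L))) (γ : (UnitaryGroup.cmDatum L 3 H').Local v),
        BorelSpace ((UnitaryGroup.cmDatum L 3 H').Local v ⧸ Subgroup.centralizer ({γ} : Set ((UnitaryGroup.cmDatum L 3 H').Local v)))]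


/-- **THE `hS` JUNCTION — the split clause of N6 from the transfer clause for every canonical pair.** For `H′` `c`-hermitian (`hherm`) and anisotropic
(`hanis`): if at every finite `v` that splits in `L` (`c • w ≠ w` for some `w ∣ v`) EVERY pair `(mH, mG)` of families canonical on the (`G`-)regular classes for
`(νH_v, νG_v)` admits `Δ‴_v`-transfers of all smooth compactly supported `φ` (`hT` — the head of the «D-N6s» chain), then the `hS` clause of ★
`localTransferExplicit_of_split_of_nonsplit` holds: the canonical pair EXISTS (★ `exists_isCanonical_pair`, with `det H′ ≠ 0` from anisotropy).
[cite: Rogawski1990, §4.9 Prop. 4.9.1 (a) p. 55; §4.3 (4.3.1) p. 43] -/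
theorem localTransferExplicit_splitHalf_of_transfer
    (hherm : (H'.map (cmConjRingHom L)).transpose = H') (hanis : ∀ x : Fin 3 → L, hermForm (cmConjRingHom L) H' x x = 0 → x = 0)
    (hT : ∀ (v : HeightOneSpectrum (𝓞 ↥(maximalRealSubfield L))) (w : UnitaryGroup.PlacesOver L v), IsCMField.complexConj L • w.1 ≠ w.1 →
      ∀ (mH : OrbitalMeasureFamily ((UnitaryGroup.cmDatum L 2 (Matrix.of fun i j : Fin 2 => if i.val + j.val + 1 = 2 then (1 : L) else 0)).Local v ×
        (UnitaryGroup.cmDatum L 1 (Matrix.of fun i j : Fin 1 => if i.val + j.val + 1 = 1 then (1 : L) else 0)).Local v))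
        (mG : OrbitalMeasureFamily ((UnitaryGroup.cmDatum L 3 H').Local v)),
        mH.IsCanonical (IsLocalGRegular L v) (νH v) →
          mG.IsCanonical (fun γ => IsRegularElt (γ.val : GL (Fin 3) (UnitaryGroup.LocalRing L v))) (νG v) →
            IsLocalDeltaTransferExists L H' v
              ((finExplicitCollection L H' μ (finExplicitDelta_conj_left_all L H' μ) (finExplicitDelta_conj_right_all L H' μ)) v) mH mG IsLocSmooth IsLocSmooth) :
    ∀ v : HeightOneSpectrum (𝓞 ↥(maximalRealSubfield L)), (∃ w : UnitaryGroup.PlacesOver L v, IsCMField.complexConj L • w.1 ≠ w.1) →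
      ∃ (mH : OrbitalMeasureFamily ((UnitaryGroup.cmDatum L 2 (Matrix.of fun i j : Fin 2 => if i.val + j.val + 1 = 2 then (1 : L) else 0)).Local v ×
        (UnitaryGroup.cmDatum L 1 (Matrix.of fun i j : Fin 1 => if i.val + j.val + 1 = 1 then (1 : L) else 0)).Local v))
        (mG : OrbitalMeasureFamily ((UnitaryGroup.cmDatum L 3 H').Local v)),
        (mH.IsCanonical (IsLocalGRegular L v) (νH v) ∧
            mG.IsCanonical (fun γ => IsRegularElt (γ.val : GL (Fin 3) (UnitaryGroup.LocalRing L v))) (νG v)) ∧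
          IsLocalDeltaTransferExists L H' v
            ((finExplicitCollection L H' μ (finExplicitDelta_conj_left_all L H' μ) (finExplicitDelta_conj_right_all L H' μ)) v) mH mG IsLocSmooth IsLocSmooth := by
  intro v ⟨w, hw⟩
  have hH'c : (H'.map (IsCMField.complexConj L))ᵀ = H' := (UnitaryGroup.map_cmConjRingHom_eq_map_complexConj L H') ▸ hherm
  obtain ⟨mH, mG, hmH, hmG⟩ := exists_isCanonical_pair L H' hH'c (Ne.isUnit (det_ne_zero_of_anisotropic' hanis)) v (νH v) (νG v)
  exact ⟨mH, mG, ⟨hmH, hmG⟩, hT v w hw mH mG hmH hmG⟩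

/-- **N6 AT A FRAME ⟸ (transfer for every canonical pair at the split places) ∧ N6-ns** — ★ B-p08's `localTransferExplicit_of_split_of_nonsplitLetter` with
its `hS` discharged by `localTransferExplicit_splitHalf_of_transfer`. [cite: Rogawski1990, §4.9 Prop. 4.9.1 (a) p. 55] [cite: LanglandsShelstad1990Descent, Thm. 6.2] -/
theorem localTransferExplicit_of_transfer_of_nonsplitLetter
    (hherm : (H'.map (cmConjRingHom L)).transpose = H') (hanis : ∀ x : Fin 3 → L, hermForm (cmConjRingHom L) H' x x = 0 → x = 0)
    (hT : ∀ (v : HeightOneSpectrum (𝓞 ↥(maximalRealSubfield L))) (w : UnitaryGroup.PlacesOver L v), IsCMField.complexConj L • w.1 ≠ w.1 →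
      ∀ (mH : OrbitalMeasureFamily ((UnitaryGroup.cmDatum L 2 (Matrix.of fun i j : Fin 2 => if i.val + j.val + 1 = 2 then (1 : L) else 0)).Local v ×
        (UnitaryGroup.cmDatum L 1 (Matrix.of fun i j : Fin 1 => if i.val + j.val + 1 = 1 then (1 : L) else 0)).Local v))
        (mG : OrbitalMeasureFamily ((UnitaryGroup.cmDatum L 3 H').Local v)),
        mH.IsCanonical (IsLocalGRegular L v) (νH v) →
          mG.IsCanonical (fun γ => IsRegularElt (γ.val : GL (Fin 3) (UnitaryGroup.LocalRing L v))) (νG v) →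
            IsLocalDeltaTransferExists L H' v
              ((finExplicitCollection L H' μ (finExplicitDelta_conj_left_all L H' μ) (finExplicitDelta_conj_right_all L H' μ)) v) mH mG IsLocSmooth IsLocSmooth)
    (hns : LocalTransferExplicitNonsplit L H' μ νH νG) :
    LocalTransferExplicit L H' μ νH νG :=
  localTransferExplicit_of_split_of_nonsplitLetter (iH := iH) (bH := bH) (iG := iG) (bG := bG) L H' μ νH νG
    (localTransferExplicit_splitHalf_of_transfer (iH := iH) (iG := iG) L H' μ νH νG hherm hanis hT) hns

/-- **THE TRANSFER CLAUSE FOR EVERY CANONICAL PAIR AT A SPLIT PLACE** (`hT` of `localTransferExplicit_splitHalf_of_transfer`, DISCHARGED): under the guards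
`hμω` (`μ|_{𝕀_{L⁺}} = ω_{L∕L⁺}`), `hherm`, `hanis`, at every finite `v` split in `L` every canonical pair `(mH, mG)` admits `Δ‴_v`-transfers — ★ B-p12's
`isLocalDeltaTransferExists_finExplicit_of_split` (B5-A PART 2 (b): Levi descent to `GL₂ × GL₁`, ★ B5-L ∕ B5-R ∕ B6 ∕ (A1)) with its frame data CHOSEN:
`hc` ★ `IsCMField.complexConj_ne_one`, `hΦ_n` ★ `UnitaryGroup.antidiagOne_map_transpose`, `hΦ_nw` ★ `UnitaryGroup.isUnit_placeForm_antidiagOne`, `hH′` from `hherm` (★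
`map_cmConjRingHom_eq_map_complexConj`), `hH′w` from `det H′ ≠ 0` (anisotropy), `det Φ_n ≠ 0` computed, the Borel σ-algebra on `L_w`, and `hdual` ★
`HeckeCharacter.galConj_eq_inv_of_restrict_eq_quadraticHeckeCharCM μ hμω`. [cite: Rogawski1990, §4.9 Prop. 4.9.1 (a) p. 55; §4.13 Lemma 4.13.1 (a) pp. 64–66] -/
theorem isLocalDeltaTransferExists_finExplicit_of_split_of_isCanonical
    (hμω : ∀ x : ideleGroup ↥(maximalRealSubfield L), μ (AdeleRing.ideleBaseChange (↥(maximalRealSubfield L)) L x) = quadraticHeckeCharCM L x)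
    (hherm : (H'.map (cmConjRingHom L)).transpose = H') (hanis : ∀ x : Fin 3 → L, hermForm (cmConjRingHom L) H' x x = 0 → x = 0) :
    ∀ (v : HeightOneSpectrum (𝓞 ↥(maximalRealSubfield L))) (w : UnitaryGroup.PlacesOver L v), IsCMField.complexConj L • w.1 ≠ w.1 →
      ∀ (mH : OrbitalMeasureFamily ((UnitaryGroup.cmDatum L 2 (Matrix.of fun i j : Fin 2 => if i.val + j.val + 1 = 2 then (1 : L) else 0)).Local v ×
        (UnitaryGroup.cmDatum L 1 (Matrix.of fun i j : Fin 1 => if i.val + j.val + 1 = 1 then (1 : L) else 0)).Local v))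
        (mG : OrbitalMeasureFamily ((UnitaryGroup.cmDatum L 3 H').Local v)),
        mH.IsCanonical (IsLocalGRegular L v) (νH v) →
          mG.IsCanonical (fun γ => IsRegularElt (γ.val : GL (Fin 3) (UnitaryGroup.LocalRing L v))) (νG v) →
            IsLocalDeltaTransferExists L H' v
              ((finExplicitCollection L H' μ (finExplicitDelta_conj_left_all L H' μ) (finExplicitDelta_conj_right_all L H' μ)) v) mH mG IsLocSmooth IsLocSmooth := by
  intro v w hw mH mG hmH hmG
  letI : MeasurableSpace (w.1.adicCompletion L) := borel _
  haveI : BorelSpace (w.1.adicCompletion L) := ⟨rfl⟩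
  have hdet : H'.det ≠ 0 := det_ne_zero_of_anisotropic' hanis
  have hΦ₂d : (Matrix.of fun i j : Fin 2 => if i.val + j.val + 1 = 2 then (1 : L) else 0).det ≠ 0 := by
    have h : (Matrix.of fun i j : Fin 2 => if i.val + j.val + 1 = 2 then (1 : L) else 0) = !![0, 1; 1, 0] := by
      ext i j; fin_cases i <;> fin_cases j <;> rfl
    rw [h, Matrix.det_fin_two_of]; norm_num
  have hΦ₁d : (Matrix.of fun i j : Fin 1 => if i.val + j.val + 1 = 1 then (1 : L) else 0).det ≠ 0 := by
    rw [Matrix.det_fin_one, Matrix.of_apply]; norm_num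
  have hΦ₂' : ((Matrix.of fun i j : Fin 2 => if i.val + j.val + 1 = 2 then (1 : L) else 0).map (cmConjRingHom L))ᵀ =
      Matrix.of fun i j : Fin 2 => if i.val + j.val + 1 = 2 then (1 : L) else 0 := by
    rw [UnitaryGroup.map_cmConjRingHom_eq_map_complexConj]; exact UnitaryGroup.antidiagOne_map_transpose (IsCMField.complexConj L) 2
  have hΦ₁' : ((Matrix.of fun i j : Fin 1 => if i.val + j.val + 1 = 1 then (1 : L) else 0).map (cmConjRingHom L))ᵀ =
      Matrix.of fun i j : Fin 1 => if i.val + j.val + 1 = 1 then (1 : L) else 0 := by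
    rw [UnitaryGroup.map_cmConjRingHom_eq_map_complexConj]; exact UnitaryGroup.antidiagOne_map_transpose (IsCMField.complexConj L) 1
  have hH'c : (H'.map (IsCMField.complexConj L))ᵀ = H' := (UnitaryGroup.map_cmConjRingHom_eq_map_complexConj L H') ▸ hherm
  exact isLocalDeltaTransferExists_finExplicit_of_split L H' (IsCMField.complexConj_ne_one L) w hw
    (UnitaryGroup.antidiagOne_map_transpose (IsCMField.complexConj L) 2) (UnitaryGroup.isUnit_placeForm_antidiagOne (E := L) 2 w.1)
    (UnitaryGroup.antidiagOne_map_transpose (IsCMField.complexConj L) 1) (UnitaryGroup.isUnit_placeForm_antidiagOne (E := L) 1 w.1)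
    hH'c (UnitaryGroup.isUnit_placeForm_of_isUnit_det (Ne.isUnit hdet) w.1) hΦ₂' hΦ₂d hΦ₁' hΦ₁d μ
    (finExplicitDelta_conj_left_all L H' μ) (finExplicitDelta_conj_right_all L H' μ)
    (HeckeCharacter.galConj_eq_inv_of_restrict_eq_quadraticHeckeCharCM L μ hμω) (νH v) (νG v) mH mG hmH hmG

/-- **THE `hS` CLAUSE OF N6 HOLDS** (the split half of letter N6, #102, in-house): under `hμω`, `hherm`, `hanis`, at every finite `v` split in `L` there are
CANONICAL families `(mH, mG)` (★ `exists_isCanonical_pair`) with `Δ‴_v`-transfers for all smooth compactly supported `φ`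
(`isLocalDeltaTransferExists_finExplicit_of_split_of_isCanonical`) — EXACTLY the `hS` binder of ★ `localTransferExplicit_of_split_of_nonsplit` ∕ ★
`localTransferExplicit_of_split_of_nonsplitLetter`. [cite: Rogawski1990, §4.9 Prop. 4.9.1 (a) p. 55; §4.3 (4.3.1) p. 43] -/
theorem localTransferExplicit_splitHalf
    (hμω : ∀ x : ideleGroup ↥(maximalRealSubfield L), μ (AdeleRing.ideleBaseChange (↥(maximalRealSubfield L)) L x) = quadraticHeckeCharCM L x)
    (hherm : (H'.map (cmConjRingHom L)).transpose = H') (hanis : ∀ x : Fin 3 → L, hermForm (cmConjRingHom L) H' x x = 0 → x = 0) :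
    ∀ v : HeightOneSpectrum (𝓞 ↥(maximalRealSubfield L)), (∃ w : UnitaryGroup.PlacesOver L v, IsCMField.complexConj L • w.1 ≠ w.1) →
      ∃ (mH : OrbitalMeasureFamily ((UnitaryGroup.cmDatum L 2 (Matrix.of fun i j : Fin 2 => if i.val + j.val + 1 = 2 then (1 : L) else 0)).Local v ×
        (UnitaryGroup.cmDatum L 1 (Matrix.of fun i j : Fin 1 => if i.val + j.val + 1 = 1 then (1 : L) else 0)).Local v))
        (mG : OrbitalMeasureFamily ((UnitaryGroup.cmDatum L 3 H').Local v)),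
        (mH.IsCanonical (IsLocalGRegular L v) (νH v) ∧
            mG.IsCanonical (fun γ => IsRegularElt (γ.val : GL (Fin 3) (UnitaryGroup.LocalRing L v))) (νG v)) ∧
          IsLocalDeltaTransferExists L H' v
            ((finExplicitCollection L H' μ (finExplicitDelta_conj_left_all L H' μ) (finExplicitDelta_conj_right_all L H' μ)) v) mH mG IsLocSmooth IsLocSmooth :=
  localTransferExplicit_splitHalf_of_transfer (iH := iH) (iG := iG) L H' μ νH νG hherm hanis
    (isLocalDeltaTransferExists_finExplicit_of_split_of_isCanonical (iH := iH) (iG := iG) L H' μ νH νG hμω hherm hanis)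

/-- **N6 AT A FRAME ⟸ N6-ns** (under `hμω`, `hherm`, `hanis`): ★ `localTransferExplicit_of_split_of_nonsplitLetter` with `hS := localTransferExplicit_splitHalf`.
[cite: Rogawski1990, §4.9 Prop. 4.9.1 (a) p. 55] [cite: LanglandsShelstad1990Descent, Thm. 6.2] -/
theorem localTransferExplicit_of_nonsplitLetter
    (hμω : ∀ x : ideleGroup ↥(maximalRealSubfield L), μ (AdeleRing.ideleBaseChange (↥(maximalRealSubfield L)) L x) = quadraticHeckeCharCM L x)
    (hherm : (H'.map (cmConjRingHom L)).transpose = H') (hanis : ∀ x : Fin 3 → L, hermForm (cmConjRingHom L) H' x x = 0 → x = 0)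
    (hns : LocalTransferExplicitNonsplit L H' μ νH νG) :
    LocalTransferExplicit L H' μ νH νG :=
  localTransferExplicit_of_split_of_nonsplitLetter (iH := iH) (bH := bH) (iG := iG) (bG := bG) L H' μ νH νG
    (localTransferExplicit_splitHalf (iH := iH) (iG := iG) L H' μ νH νG hμω hherm hanis) hns

end Frame

/-- **N6 CLOSED ⟸ N6-ns CLOSED**: `LocalTransferExplicitNonsplitClosed → LocalTransferExplicitClosed` — at every frame the split half is in-house
(`localTransferExplicit_of_nonsplitLetter`, Borel σ-algebras on the orbit spaces), so the registrable constant of letter N6 (#102) reduces to its non-split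
half ★ `LocalTransferExplicitNonsplitClosed` ([LS₂]). [cite: Rogawski1990, §4.9 Prop. 4.9.1 (a) p. 55] [cite: LanglandsShelstad1990Descent, Thm. 6.2] -/
theorem localTransferExplicitClosed_of_nonsplitClosed (hns : LocalTransferExplicitNonsplitClosed) : LocalTransferExplicitClosed :=
  fun L _ _ _ H' μ _ _ _ _ νH νG _ _ _ _ hμu hμω hherm hanis => by
    -- the letters' Borel σ-algebras on the orbit spaces, as local instances (as in ★ `localTransferExplicitClosed_of_splitClosed_of_nonsplitClosed`)
    letI : ∀ (v : HeightOneSpectrum (𝓞 ↥(maximalRealSubfield L)))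
        (a : ((UnitaryGroup.cmDatum L 2 (Matrix.of fun i j : Fin 2 => if i.val + j.val + 1 = 2 then (1 : L) else 0)).Local v ×
          (UnitaryGroup.cmDatum L 1 (Matrix.of fun i j : Fin 1 => if i.val + j.val + 1 = 1 then (1 : L) else 0)).Local v)),
        MeasurableSpace (((UnitaryGroup.cmDatum L 2 (Matrix.of fun i j : Fin 2 => if i.val + j.val + 1 = 2 then (1 : L) else 0)).Local v ×
          (UnitaryGroup.cmDatum L 1 (Matrix.of fun i j : Fin 1 => if i.val + j.val + 1 = 1 then (1 : L) else 0)).Local v) ⧸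
          Subgroup.centralizer ({a} : Set ((UnitaryGroup.cmDatum L 2 (Matrix.of fun i j : Fin 2 => if i.val + j.val + 1 = 2 then (1 : L) else 0)).Local v ×
          (UnitaryGroup.cmDatum L 1 (Matrix.of fun i j : Fin 1 => if i.val + j.val + 1 = 1 then (1 : L) else 0)).Local v))) :=
      fun _ _ => borel _
    haveI : ∀ (v : HeightOneSpectrum (𝓞 ↥(maximalRealSubfield L)))
        (a : ((UnitaryGroup.cmDatum L 2 (Matrix.of fun i j : Fin 2 => if i.val + j.val + 1 = 2 then (1 : L) else 0)).Local v ×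
          (UnitaryGroup.cmDatum L 1 (Matrix.of fun i j : Fin 1 => if i.val + j.val + 1 = 1 then (1 : L) else 0)).Local v)),
        BorelSpace (((UnitaryGroup.cmDatum L 2 (Matrix.of fun i j : Fin 2 => if i.val + j.val + 1 = 2 then (1 : L) else 0)).Local v ×
          (UnitaryGroup.cmDatum L 1 (Matrix.of fun i j : Fin 1 => if i.val + j.val + 1 = 1 then (1 : L) else 0)).Local v) ⧸
          Subgroup.centralizer ({a} : Set ((UnitaryGroup.cmDatum L 2 (Matrix.of fun i j : Fin 2 => if i.val + j.val + 1 = 2 then (1 : L) else 0)).Local v ×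
          (UnitaryGroup.cmDatum L 1 (Matrix.of fun i j : Fin 1 => if i.val + j.val + 1 = 1 then (1 : L) else 0)).Local v))) :=
      fun _ _ => ⟨rfl⟩
    letI : ∀ (v : HeightOneSpectrum (𝓞 ↥(maximalRealSubfield L))) (γ : (UnitaryGroup.cmDatum L 3 H').Local v),
        MeasurableSpace ((UnitaryGroup.cmDatum L 3 H').Local v ⧸ Subgroup.centralizer ({γ} : Set ((UnitaryGroup.cmDatum L 3 H').Local v))) :=
      fun _ _ => borel _
    haveI : ∀ (v : HeightOneSpectrum (𝓞 ↥(maximalRealSubfield L))) (γ : (UnitaryGroup.cmDatum L 3 H').Local v),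
        BorelSpace ((UnitaryGroup.cmDatum L 3 H').Local v ⧸ Subgroup.centralizer ({γ} : Set ((UnitaryGroup.cmDatum L 3 H').Local v))) :=
      fun _ _ => ⟨rfl⟩
    exact localTransferExplicit_of_nonsplitLetter L H' μ νH νG hμω hherm hanis (hns L H' μ νH νG hμu hμω hherm hanis)

end Literature.NumberTheory.Rogawski1990

end
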